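import Mathlib.Tactic
import HarnessLib
import HarnessLib.Audit.Tags
import Summits.CriticalPhenomena.PercolationContinuityZ3.Theorems.PercNearOneGluingNoHeavyLowerTailSahiAntichainDual

/-!
# Antichains, meets plus joins: a sunflower side is a good point

Support file (seat `prim-masterthm-p1`, gen 36; `--supports stmt-CriticalPhenomena-4575`).  No `sorry`, no new definitions, standard
axioms.  Memo `run/shared/lean/prim/prim-masterthm/FROM-prim-masterthm-p1-g36-*.md`.

SETTING (files `…SahiAntichainSplit*`).  `above P r` / `below P r` are the members of `P` containing / avoiding `r`, and
`newLabels P r = #newMeets P r + #newJoins P r` counts the cross labels created by the split at `r`; the split step for V5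
(`two_mul_card_le_step`) needs `newLabels P r ≥ 2`.  Known good sides: a side with one member (`…SahiAntichainSplit`), with two
members (`…SplitTwo`, `…SplitFive`), or with uniform cross joins / meets (`…SplitUniform`).

NEW HERE ([this work], gen 36).  **The sunflower step** `two_le_newLabels_of_above_sunflower`: if the members containing `r`
form a SUNFLOWER with at least three petals (all pairwise meets equal to one set `K`) and some member avoids `r`, then
`newLabels P r ≥ 2` — for ANY number of members on either side.  [Proof: a cross join `a ∪ b` that is an old join `e ∪ e'`
forces `a ∈ {e, e'}` and the other petal inside `b`; then the third member's cross join is new; bookkeeping of the two "tame"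
shapes `b ⊇ all petals` and `b ⊆ a ∪ e, b ⊇ both petals` (the latter only for three petals) produces a second new label: a
new meet inside `K`.]  The case of three petals with three tame members of the second shape is the blow-up of `C([4],2)`, where
`newLabels = 2` exactly.  By complement duality (`…SahiAntichainDual`) the **co-sunflower step**
`two_le_newLabels_of_below_cosunflower` follows: if the members avoiding `r` have all pairwise UNIONS equal (≥ 3 of them),
`newLabels P r ≥ 2`.  Consequence for the V5 induction: at a bad point (`newLabels ≤ 1`) neither side is a pair, a 3-sunflower
(above) or a 3-co-sunflower (below) — three of the four V5-tight shapes are excluded as sides.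
HONEST FRAMING: V5 itself remains OPEN. [this work]
-/

namespace Summit.CriticalPhenomena.PercolationContinuityZ3.Theorems.SahiColouredDaykin

open Finset

variable {α : Type*} [DecidableEq α]

/-! ### 1. Two new labels suffice -/

/-- Two distinct new joins give `newLabels ≥ 2`. [this work] -/
theorem two_le_newLabels_of_two_newJoins {P : Finset (Finset α)} {r : α} {W₁ W₂ : Finset α}
    (h₁ : W₁ ∈ newJoins P r) (h₂ : W₂ ∈ newJoins P r) (hne : W₁ ≠ W₂) : 2 ≤ newLabels P r := by
  unfold newLabels
  have : 2 ≤ #(newJoins P r) := by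
    have hsub : ({W₁, W₂} : Finset (Finset α)) ⊆ newJoins P r := by
      intro W hW
      rcases mem_insert.1 hW with rfl | hW
      · exact h₁
      · rw [mem_singleton.1 hW]; exact h₂
    have := card_le_card hsub
    rwa [card_pair hne] at this
  omega

/-- A new meet and a new join give `newLabels ≥ 2`. [this work] -/
theorem two_le_newLabels_of_newMeet_newJoin {P : Finset (Finset α)} {r : α} {Z W : Finset α}
    (hZ : Z ∈ newMeets P r) (hW : W ∈ newJoins P r) : 2 ≤ newLabels P r := by
  unfold newLabels
  have h1 : 1 ≤ #(newMeets P r) := card_pos.2 ⟨_, hZ⟩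
  have h2 : 1 ≤ #(newJoins P r) := card_pos.2 ⟨_, hW⟩
  omega

/-- Unpacking `newJoins`: a cross join `a ∪ b` (`r ∈ a`, `r ∉ b`) that is not a join of two members containing `r`. [this work] -/
theorem union_mem_newJoins_iff {P : Finset (Finset α)} {r : α} {a b : Finset α}
    (ha : a ∈ above P r) (hb : b ∈ below P r) : a ∪ b ∈ newJoins P r ↔ a ∪ b ∉ joins (above P r) := by
  unfold newJoins
  rw [mem_sdiff]
  obtain ⟨haP, hra⟩ := mem_above_iff.1 ha
  obtain ⟨hbP, hrb⟩ := mem_below_iff.1 hb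
  exact ⟨fun h => h.2, fun h => ⟨mem_crossJoins_iff.2 ⟨a, haP, b, hbP, hra, hrb, rfl⟩, h⟩⟩

/-- Unpacking `newMeets`: a cross meet `a ∩ b` that is not a meet of two members avoiding `r`. [this work] -/
theorem inter_mem_newMeets_iff {P : Finset (Finset α)} {r : α} {a b : Finset α}
    (ha : a ∈ above P r) (hb : b ∈ below P r) : a ∩ b ∈ newMeets P r ↔ a ∩ b ∉ meets (below P r) := by
  unfold newMeets
  rw [mem_sdiff]
  obtain ⟨haP, hra⟩ := mem_above_iff.1 ha
  obtain ⟨hbP, hrb⟩ := mem_below_iff.1 hb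
  exact ⟨fun h => h.2, fun h => ⟨mem_crossMeets_iff.2 ⟨a, haP, b, hbP, hra, hrb, rfl⟩, h⟩⟩

/-! ### 2. Sunflower bookkeeping -/

section Sunflower

variable {P : Finset (Finset α)} {r : α} {K : Finset α}

/-- In a sunflower side with ≥ 2 members every member contains the core. [this work] -/
theorem core_subset_of_sunflower (h2 : 1 < #(above P r)) (hK : ∀ a ∈ above P r, ∀ a' ∈ above P r, a ≠ a' → a ∩ a' = K)
    {a : Finset α} (ha : a ∈ above P r) : K ⊆ a := by
  obtain ⟨a', ha', hne⟩ := exists_mem_ne h2 a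
  rw [← hK a ha a' ha' hne.symm]
  exact inter_subset_left

/-- Petals are disjoint: a point of two distinct members lies in the core. [this work] -/
theorem mem_core_of_mem_mem (hK : ∀ a ∈ above P r, ∀ a' ∈ above P r, a ≠ a' → a ∩ a' = K)
    {a a' : Finset α} (ha : a ∈ above P r) (ha' : a' ∈ above P r) (hne : a ≠ a') {x : α} (hx : x ∈ a) (hx' : x ∈ a') :
    x ∈ K := by
  rw [← hK a ha a' ha' hne]; exact mem_inter.2 ⟨hx, hx'⟩

/-- Petals are nonempty: every member of an antichain sunflower side has a point outside the core. [this work] -/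
theorem exists_mem_not_mem_core (hanti : IsAntichain (· ⊆ ·) (P : Set (Finset α))) (h2 : 1 < #(above P r))
    (hK : ∀ a ∈ above P r, ∀ a' ∈ above P r, a ≠ a' → a ∩ a' = K) {a : Finset α} (ha : a ∈ above P r) :
    ∃ x ∈ a, x ∉ K := by
  obtain ⟨a', ha', hne⟩ := exists_mem_ne h2 a
  have hnot : ¬ a ⊆ a' := hanti (mem_coe.2 (above_subset P r ha)) (mem_coe.2 (above_subset P r ha')) hne.symm
  obtain ⟨x, hxa, hxa'⟩ := not_subset.1 hnot
  exact ⟨x, hxa, fun hxK => hxa' (core_subset_of_sunflower h2 hK ha' hxK)⟩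

/-- **Old cross joins.**  If `a ∪ b` (`a` above, `b` below) is a join of two members above `r`, then some OTHER member `e`
above `r` has its petal inside `b`, and `b ⊆ a ∪ e`. [this work] -/
theorem exists_swallowed_of_union_mem_joins (hanti : IsAntichain (· ⊆ ·) (P : Set (Finset α))) (h2 : 1 < #(above P r))
    (hK : ∀ a ∈ above P r, ∀ a' ∈ above P r, a ≠ a' → a ∩ a' = K) {a b : Finset α} (ha : a ∈ above P r)
    (hold : a ∪ b ∈ joins (above P r)) :
    ∃ e ∈ above P r, e ≠ a ∧ (∀ x ∈ e, x ∉ K → x ∈ b) ∧ b ⊆ a ∪ e := by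
  obtain ⟨e₁, he₁, e₂, he₂, hne, heq⟩ := mem_joins_iff.1 hold
  obtain ⟨x, hxa, hxK⟩ := exists_mem_not_mem_core hanti h2 hK ha
  -- `a` is one of `e₁, e₂`
  have key : ∀ {e e' : Finset α}, e ∈ above P r → e' ∈ above P r → e ≠ e' → a ∪ b = e ∪ e' → x ∈ e →
      ∃ f ∈ above P r, f ≠ a ∧ (∀ y ∈ f, y ∉ K → y ∈ b) ∧ b ⊆ a ∪ f := by
    intro e e' he he' hee' hab hxe
    have hea : e = a := by
      by_contra h
      exact hxK (mem_core_of_mem_mem hK he ha h hxe hxa)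
    subst hea
    refine ⟨e', he', hee'.symm, ?_, ?_⟩
    · intro y hy hyK
      have : y ∈ e ∪ b := by rw [hab]; exact mem_union_right _ hy
      rcases mem_union.1 this with h | h
      · exact absurd (mem_core_of_mem_mem hK he' he hee'.symm hy h) hyK
      · exact h
    · intro z hz
      have : z ∈ e ∪ b := mem_union_right _ hz
      rwa [hab] at this
  have hx : x ∈ e₁ ∪ e₂ := by rw [← heq]; exact mem_union_left _ hxa
  rcases mem_union.1 hx with h | h
  · exact key he₁ he₂ hne heq h
  · exact key he₂ he₁ hne.symm (by rw [heq, union_comm]) h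

/-- **The third member's cross join is new.**  If `e`'s petal lies inside `b ⊆ a ∪ e` (`a ≠ e` above `r`, `b` below `r`),
then for every third member `d` above `r` the cross join `d ∪ b` is not an old join. [this work] -/
theorem union_not_mem_joins_of_third (hanti : IsAntichain (· ⊆ ·) (P : Set (Finset α))) (h2 : 1 < #(above P r))
    (hK : ∀ a ∈ above P r, ∀ a' ∈ above P r, a ≠ a' → a ∩ a' = K) {a e d b : Finset α} (ha : a ∈ above P r)
    (he : e ∈ above P r) (hd : d ∈ above P r) (hb : b ∈ below P r) (hae : a ≠ e) (hda : d ≠ a) (hde : d ≠ e)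
    (hsw : ∀ x ∈ e, x ∉ K → x ∈ b) (hbae : b ⊆ a ∪ e) : d ∪ b ∉ joins (above P r) := by
  intro hold
  obtain ⟨e', he', hne', hsw', hb'⟩ := exists_swallowed_of_union_mem_joins hanti h2 hK hd hold
  obtain ⟨x, hxe, hxK⟩ := exists_mem_not_mem_core hanti h2 hK he
  have hxb : x ∈ b := hsw x hxe hxK
  -- `x ∈ b ⊆ d ∪ e'` forces `e' = e`
  have hee' : e' = e := by
    rcases mem_union.1 (hb' hxb) with h | h
    · exact absurd (mem_core_of_mem_mem hK he hd hde.symm hxe h) hxK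
    · by_contra hne
      exact hxK (mem_core_of_mem_mem hK he he' (Ne.symm hne) hxe h)
  subst hee'
  -- then `b ⊆ (a ∪ e') ∩ (d ∪ e') ⊆ e'`, contradicting the antichain property
  have hbe : b ⊆ e' := by
    intro z hz
    rcases mem_union.1 (hbae hz) with hza | hze
    · rcases mem_union.1 (hb' hz) with hzd | hze
      · exact core_subset_of_sunflower h2 hK he' (mem_core_of_mem_mem hK ha hd hda.symm hza hzd)
      · exact hze
    · exact hze
  obtain ⟨hbP, hrb⟩ := mem_below_iff.1 hb
  obtain ⟨he'P, hre'⟩ := mem_above_iff.1 he'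
  have hne : b ≠ e' := by rintro rfl; exact hrb hre'
  exact hanti (mem_coe.2 hbP) (mem_coe.2 he'P) hne hbe

/-- Distinct members whose petals are not inside `b` have distinct cross joins with `b`. [this work] -/
theorem union_ne_union_of_not_swallowed (hK : ∀ a ∈ above P r, ∀ a' ∈ above P r, a ≠ a' → a ∩ a' = K)
    {d d' b : Finset α} (hd : d ∈ above P r) (hd' : d' ∈ above P r) (hne : d ≠ d') {x : α} (hxd : x ∈ d) (hxK : x ∉ K)
    (hxb : x ∉ b) : d ∪ b ≠ d' ∪ b := by
  intro h
  have : x ∈ d' ∪ b := by rw [← h]; exact mem_union_left _ hxd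
  rcases mem_union.1 this with h' | h'
  · exact hxK (mem_core_of_mem_mem hK hd hd' hne hxd h')
  · exact hxb h'

/-- A third member distinct from two given ones exists in a side with ≥ 3 members. [this work] -/
theorem exists_third {A : Finset (Finset α)} (h3 : 3 ≤ #A) (a e : Finset α) : ∃ d ∈ A, d ≠ a ∧ d ≠ e := by
  obtain ⟨x, hx, y, hy, z, hz, hxy, hxz, hyz⟩ := two_lt_card.1 (by omega : 2 < #A)
  by_cases hxa : x = a
  · by_cases hye : y = e
    · exact ⟨z, hz, fun h => hxz (hxa.trans h.symm), fun h => hyz (hye.trans h.symm)⟩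
    · by_cases hya : y = a
      · exact absurd (hxa.trans hya.symm) hxy
      · exact ⟨y, hy, hya, hye⟩
  · by_cases hxe : x = e
    · by_cases hya : y = a
      · by_cases hza : z = a
        · exact absurd (hya.trans hza.symm) hyz
        · exact ⟨z, hz, hza, fun h => hxz (hxe.trans h.symm)⟩
      · by_cases hye : y = e
        · exact absurd (hxe.trans hye.symm) hxy
        · exact ⟨y, hy, hya, hye⟩
    · exact ⟨x, hx, hxa, hxe⟩

/-! ### 3. The sunflower step -/

/-- **The sunflower step.**  If the members containing `r` form a sunflower with at least three petals (all pairwise meets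
equal to `K`) and some member avoids `r`, the split at `r` creates at least two new labels. [this work] -/
theorem two_le_newLabels_of_above_sunflower (hanti : IsAntichain (· ⊆ ·) (P : Set (Finset α)))
    (h3 : 3 ≤ #(above P r)) (hB : (below P r).Nonempty)
    (hK : ∀ a ∈ above P r, ∀ a' ∈ above P r, a ≠ a' → a ∩ a' = K) : 2 ≤ newLabels P r := by
  have h2 : 1 < #(above P r) := by omega
  by_contra hlt
  -- Tameness of every member avoiding `r`: type α' (swallows every petal, all cross joins new) or
  -- type β (swallowed petals of `a, e` and `b ⊆ a ∪ e`).
  have tame : ∀ b ∈ below P r,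
      (∀ a ∈ above P r, a ∪ b ∉ joins (above P r) ∧ ∀ x ∈ a, x ∉ K → x ∈ b) ∨
      (∃ a ∈ above P r, ∃ e ∈ above P r, a ≠ e ∧ (∀ x ∈ a, x ∉ K → x ∈ b) ∧ (∀ x ∈ e, x ∉ K → x ∈ b) ∧ b ⊆ a ∪ e) := by
    intro b hb
    by_cases hold : ∃ a ∈ above P r, a ∪ b ∈ joins (above P r)
    · -- some cross join over `b` is old
      right
      obtain ⟨a, ha, hab⟩ := hold
      obtain ⟨e, he, hea, hsw, hbae⟩ := exists_swallowed_of_union_mem_joins hanti h2 hK ha hab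
      obtain ⟨d, hd, hda, hde⟩ := exists_third h3 a e
      have hdnew : d ∪ b ∈ newJoins P r :=
        (union_mem_newJoins_iff hd hb).2 (union_not_mem_joins_of_third hanti h2 hK ha he hd hb hea.symm hda hde hsw hbae)
      -- the cross join over `e`: new would give a second new join
      obtain ⟨x, hxd, hxK⟩ := exists_mem_not_mem_core hanti h2 hK hd
      have hxb : x ∉ b := by
        intro hxb
        rcases mem_union.1 (hbae hxb) with h | h
        · exact hxK (mem_core_of_mem_mem hK hd ha hda hxd h)
        · exact hxK (mem_core_of_mem_mem hK hd he hde hxd h)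
      by_cases heold : e ∪ b ∈ joins (above P r)
      · obtain ⟨e'', he'', hne'', hsw'', hb''⟩ := exists_swallowed_of_union_mem_joins hanti h2 hK he heold
        -- `e'' = a`: a petal point of `e''` lies in `b ⊆ a ∪ e`
        obtain ⟨y, hye'', hyK⟩ := exists_mem_not_mem_core hanti h2 hK he''
        have hyb : y ∈ b := hsw'' y hye'' hyK
        have he''a : e'' = a := by
          rcases mem_union.1 (hbae hyb) with h | h
          · by_contra hne
            exact hyK (mem_core_of_mem_mem hK he'' ha hne hye'' h)
          · exact absurd (mem_core_of_mem_mem hK he'' he hne'' hye'' h) hyK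
        subst he''a
        exact ⟨e'', ha, e, he, hea.symm, hsw'', hsw, hbae⟩
      · exact absurd (two_le_newLabels_of_two_newJoins hdnew ((union_mem_newJoins_iff he hb).2 heold)
          (union_ne_union_of_not_swallowed hK hd he hde hxd hxK hxb)) hlt
    · -- every cross join over `b` is new: they must all coincide
      left
      push Not at hold
      intro a ha
      refine ⟨hold a ha, ?_⟩
      intro x hxa hxK
      obtain ⟨a', ha', hne⟩ := exists_mem_ne h2 a
      by_contra hxb
      exact hlt (two_le_newLabels_of_two_newJoins ((union_mem_newJoins_iff ha hb).2 (hold a ha))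
        ((union_mem_newJoins_iff ha' hb).2 (hold a' ha')) (union_ne_union_of_not_swallowed hK ha ha' hne.symm hxa hxK hxb))
  -- Type β is impossible with four or more petals; with three petals it yields a new meet inside `K`.
  by_cases hbeta : ∃ b ∈ below P r, ∃ a ∈ above P r, ∃ e ∈ above P r,
      a ≠ e ∧ (∀ x ∈ a, x ∉ K → x ∈ b) ∧ (∀ x ∈ e, x ∉ K → x ∈ b) ∧ b ⊆ a ∪ e
  · obtain ⟨b, hb, a, ha, e, he, hae, hswa, hswe, hbae⟩ := hbeta
    obtain ⟨d, hd, hda, hde⟩ := exists_third h3 a e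
    have hdnew : d ∪ b ∈ newJoins P r :=
      (union_mem_newJoins_iff hd hb).2 (union_not_mem_joins_of_third hanti h2 hK ha he hd hb hae hda hde hswe hbae)
    -- petal points of members other than `a, e` avoid `b`
    have havoid : ∀ d' ∈ above P r, d' ≠ a → d' ≠ e → ∀ x ∈ d', x ∉ K → x ∉ b := by
      intro d' hd' hd'a hd'e x hx hxK hxb
      rcases mem_union.1 (hbae hxb) with h | h
      · exact hxK (mem_core_of_mem_mem hK hd' ha hd'a hx h)
      · exact hxK (mem_core_of_mem_mem hK hd' he hd'e hx h)
    -- a fourth member would give a second new join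
    have honly : ∀ d' ∈ above P r, d' ≠ a → d' ≠ e → d' = d := by
      intro d' hd' hd'a hd'e
      by_contra hd'd
      obtain ⟨x, hxd', hxK⟩ := exists_mem_not_mem_core hanti h2 hK hd'
      have hd'new : d' ∪ b ∈ newJoins P r :=
        (union_mem_newJoins_iff hd' hb).2 (union_not_mem_joins_of_third hanti h2 hK ha he hd' hb hae hd'a hd'e hswe hbae)
      exact hlt (two_le_newLabels_of_two_newJoins hd'new hdnew
        (union_ne_union_of_not_swallowed hK hd' hd hd'd hxd' hxK (havoid d' hd' hd'a hd'e x hxd' hxK)))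
    -- the new meet `d ∩ b ⊆ K`
    have hZ : d ∩ b ∈ newMeets P r := by
      rw [inter_mem_newMeets_iff hd hb]
      intro hold
      obtain ⟨g, hg, g', hg', hgg', heq⟩ := mem_meets_iff.1 hold
      -- `d ∩ b ⊆ K`
      have hdbK : ∀ z ∈ d ∩ b, z ∈ K := by
        intro z hz
        obtain ⟨hzd, hzb⟩ := mem_inter.1 hz
        rcases mem_union.1 (hbae hzb) with h | h
        · exact mem_core_of_mem_mem hK hd ha hda hzd h
        · exact mem_core_of_mem_mem hK hd he hde hzd h
      -- a member swallowed by both `g` and `g'`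
      have hcommon : ∃ m ∈ above P r, (∀ x ∈ m, x ∉ K → x ∈ g) ∧ (∀ x ∈ m, x ∉ K → x ∈ g') := by
        rcases tame g hg with hα | ⟨a₁, ha₁, e₁, he₁, hne₁, hs₁, hs₁', hsub₁⟩
        · rcases tame g' hg' with hα' | ⟨a₂, ha₂, e₂, he₂, _, hs₂, _, _⟩
          · exact ⟨a, ha, (hα a ha).2, (hα' a ha).2⟩
          · exact ⟨a₂, ha₂, (hα a₂ ha₂).2, hs₂⟩
        · rcases tame g' hg' with hα' | ⟨a₂, ha₂, e₂, he₂, hne₂, hs₂, hs₂', _⟩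
          · exact ⟨a₁, ha₁, hs₁, (hα' a₁ ha₁).2⟩
          · -- two pairs inside the three-element side `{a, e, d}` share a member
            have h3set : ∀ m ∈ above P r, m = a ∨ m = e ∨ m = d := by
              intro m hm
              by_cases hma : m = a
              · exact Or.inl hma
              by_cases hme : m = e
              · exact Or.inr (Or.inl hme)
              exact Or.inr (Or.inr (honly m hm hma hme))
            -- enumerate
            by_cases h12 : a₁ = a₂
            · subst h12; exact ⟨a₁, ha₁, hs₁, hs₂⟩
            by_cases h12' : a₁ = e₂
            · subst h12'; exact ⟨a₁, ha₁, hs₁, hs₂'⟩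
            by_cases h1'2 : e₁ = a₂
            · subst h1'2; exact ⟨e₁, he₁, hs₁', hs₂⟩
            by_cases h1'2' : e₁ = e₂
            · subst h1'2'; exact ⟨e₁, he₁, hs₁', hs₂'⟩
            · -- a₁, e₁, a₂, e₂ would be four distinct members of a three-element set
              exfalso
              rcases h3set a₁ ha₁ with r1 | r1 | r1 <;> rcases h3set e₁ he₁ with r2 | r2 | r2 <;>
                rcases h3set a₂ ha₂ with r3 | r3 | r3 <;> rcases h3set e₂ he₂ with r4 | r4 | r4 <;>
                first
                | exact hne₁ (r1.trans r2.symm)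
                | exact hne₂ (r3.trans r4.symm)
                | exact h12 (r1.trans r3.symm)
                | exact h12' (r1.trans r4.symm)
                | exact h1'2 (r2.trans r3.symm)
                | exact h1'2' (r2.trans r4.symm)
      obtain ⟨m, hm, hmg, hmg'⟩ := hcommon
      obtain ⟨x, hxm, hxK⟩ := exists_mem_not_mem_core hanti h2 hK hm
      have hx : x ∈ d ∩ b := by rw [heq]; exact mem_inter.2 ⟨hmg x hxm hxK, hmg' x hxm hxK⟩
      exact hxK (hdbK x hx)
    exact hlt (two_le_newLabels_of_newMeet_newJoin hZ hdnew)
  · -- every member avoiding `r` is of type α'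
    push Not at hbeta
    have hα : ∀ b ∈ below P r, ∀ a ∈ above P r, a ∪ b ∉ joins (above P r) ∧ ∀ x ∈ a, x ∉ K → x ∈ b := by
      intro b hb
      rcases tame b hb with h | ⟨a, ha, e, he, hae, hswa, hswe, hbae⟩
      · exact h
      · exact absurd hbae (hbeta b hb a ha e he hae hswa hswe)
    obtain ⟨b₀, hb₀⟩ := hB
    obtain ⟨a₁, a₂, ha₁, ha₂, hne⟩ := one_lt_card_iff.1 h2
    have hW : a₁ ∪ b₀ ∈ newJoins P r := (union_mem_newJoins_iff ha₁ hb₀).2 (hα b₀ hb₀ a₁ ha₁).1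
    have hZ : a₁ ∩ b₀ ∈ newMeets P r := by
      rw [inter_mem_newMeets_iff ha₁ hb₀]
      intro hold
      obtain ⟨g, hg, g', hg', _, heq⟩ := mem_meets_iff.1 hold
      obtain ⟨x, hx₂, hxK⟩ := exists_mem_not_mem_core hanti h2 hK ha₂
      have hx : x ∈ a₁ ∩ b₀ := by
        rw [heq]; exact mem_inter.2 ⟨(hα g hg a₂ ha₂).2 x hx₂ hxK, (hα g' hg' a₂ ha₂).2 x hx₂ hxK⟩
      exact hxK (mem_core_of_mem_mem hK ha₂ ha₁ hne.symm hx₂ (mem_inter.1 hx).1)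
    exact hlt (two_le_newLabels_of_newMeet_newJoin hZ hW)

end Sunflower

/-! ### 4. The co-sunflower step, by duality -/

/-- **The co-sunflower step.**  If the members avoiding `r` have all pairwise unions equal (at least three of them) and some
member contains `r`, the split at `r` creates at least two new labels.  [Complement duality applied to the sunflower step.] [this work] -/
theorem two_le_newLabels_of_below_cosunflower {P : Finset (Finset α)} {r : α} {U : Finset α}
    (hanti : IsAntichain (· ⊆ ·) (P : Set (Finset α)))
    (h3 : 3 ≤ #(below P r)) (hA : (above P r).Nonempty)
    (hU : ∀ b ∈ below P r, ∀ b' ∈ below P r, b ≠ b' → b ∪ b' = U) : 2 ≤ newLabels P r := by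
  set F := insert r (P.sup id) with hF
  have hP : ∀ a ∈ P, a ⊆ F := subset_insert_sup P r
  have hr : r ∈ F := mem_insert_self _ _
  rw [← newLabels_image_compl hP hr]
  refine two_le_newLabels_of_above_sunflower (K := F \ U) (isAntichain_image_compl hanti hP) ?_ ?_ ?_
  · rw [card_above_image_compl hP hr]; exact h3
  · rw [← card_pos, card_below_image_compl hP hr, card_pos]; exact hA
  · intro x hx y hy hxy
    rw [above_image_compl (P := P) hr] at hx hy
    obtain ⟨b, hb, rfl⟩ := mem_image.1 hx
    obtain ⟨b', hb', rfl⟩ := mem_image.1 hy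
    have hbb' : b ≠ b' := by rintro rfl; exact hxy rfl
    rw [← sdiff_union_distrib, hU b hb b' hb' hbb']

end Summit.CriticalPhenomena.PercolationContinuityZ3.Theorems.SahiColouredDaykin
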